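import Summits.QuantumFields.BalabanUV.Beta.GAN24.AlmostNestedLoopEnd

/-!
# `BalabanUV.Beta.GAN24.IndicatorBallAlmostNested` — binder row G-an2-4 ∕ (CONV-C), routes C-R6° («VALUES») × R7 («TWO CURRENCIES»), PART 230:
# THE NON-NESTED INSTANCE — PART 213 §4's INDICATOR BALLS `V_{t,x}^{(k)}(u)_μ = [μ = x₂]·𝟙[ρ_{k,x}(u) ≤ 0]` (`ρ_{k,x}(u) ≤ 0 ⟺ ‖u − n_k·x‖_∞ ≤ n_k` on the fine torus) ARE
# ALMOST NESTED WITH ONE DEFECT LAYER PER DIRECTION (the far faces `u_ν = n_k·x_ν + n_k`), so PART 229's V196 END HOLDS FOR THEM WITH NOTHING DISPLAYED — the first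
# family of bounded backgrounds that is NEITHER Lipschitz NOR nested for which V196's loop contraction is an unconditional theorem (census V204′ (ii); unit b2b-balaban-gan24-p3,
# gen 64; v1)

NOT IN PRINT; OUR PROOF ([folklore] elementary arithmetic of the circular sup-distance under the block map `u ↦ L·u + j`: the centred lift is the representative of least absolute
value (`ZMod.natAbs_min_of_le_div_two`), so `‖δ‖ ≤ n ⟺ δ` has a representative in `[−n, n]`, and `L·t + j` (`0 ≤ j < L`) has one in `[−Ln, Ln]` iff `t` has one in `[−n, n]`
UNLESS `t ≡ n`; NE2's `CTKingTowerWeights` (`ctr`, `rho_apply`, `toM`), `BalabanAveragedTowerModes` (`cpt_par_add_off_rem`, `val_cpt_add_off`), `B5Blocks16.bpt_val`, King's pairing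
(`JK_conjTranspose_mul_JK`, PART 228 `JK_conjTranspose_mul_diagonal_mul_JK`), PART 229 (`conv_oneLoop_loopCov_almostNestedLegs`), PART 213 §4 (`indicator_bound ∕ _loc`,
`tendsto_indicator_reading`); nothing printed is a hypothesis).
HONEST FRAMING (cell contract, verbatim): «discharging `BetaPertH` makes Bałaban's UV stability UNCONDITIONAL — a real constructive-QFT result; it is NOT the
continuum limit and NOT the Clay problem.»  HONEST DEPENDENCY (verbatim): «continuum YM on T⁴ ⇐ BetaPertH ∧ nine spine estimates (0/9 proved); BetaPertH ⇐
(D1) ∧ (D4) ∧ CAP+tail; G-an2-4 gates asym, D1 and NE2/3/4.»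

WHAT THIS FILE PROVES (0 sorry, 0 `def`; `n_k = lev L k`, `c = ctr_k x` the corner `n_k·x` of the block of `x`, children of `u` = `{(cpt u₁ + off j, u₂)}`):
* §1 ARITHMETIC: **`natAbs_valMinAbs_le_iff_exists`** (`|valMinAbs δ| ≤ r ⟺ ∃` a representative `i`, `|i| ≤ r`), **`child_ball_iff`** (for `t ≢ n (mod N)` and `0 ≤ j < L`:
  `|valMinAbs_{LN}(L·t + j)| ≤ L·n ⟺ |valMinAbs_N(t)| ≤ n`).
* §2 BLOCK SUMS: **`blockavg_const`** (`R^{−d}·Σ_{parT y = u} c = c`, from `J_Rᴴ J_R = 1`), **`eq_cpt_add_off_of_parT`** (a child of `u` is `(cpt u₁ + off (rem y₁), u₂)`).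
* §3 THE BALL GEOMETRY: **`rho_nonpos_iff`** (`ρ_{k,x}(u) ≤ 0 ⟺ ∀ ν, |valMinAbs(u₁(ν) − c_ν)| ≤ n_k`), **`val_ctr_succ`** (`c^{(k+1)}_ν = L·c^{(k)}_ν` in values), **`rho_succ_child_iff`**
  (for a child `y` of `u` with `u₁(ν) ≠ c_ν + n_k` for all `ν`: `ρ_{k+1,x}(y) ≤ 0 ⟺ ρ_{k,x}(u) ≤ 0`).
* §4 **`indicatorBall_blockavg`** — THE ALMOST-NESTING OF THE INDICATOR BALLS: off the far faces `A_{t,x,k,ν} = {c_ν + n_k}` (`m = 1`), the block average of `V^{(k+1)}_{x₂}` over the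
  children of `u` equals `V^{(k)}_{x₂}(u)`; `indicatorBall_dir`; **`conv_oneLoop_loopCov_indicatorBallLegs`** — PART 229's V196 END for the indicator balls with NOTHING displayed but
  `hVdef` (`d + 1 ≥ 3`, `L ≥ 2`, every `Lb ≥ 1`, `a > 0`, `μ ≠ ν`; step ratio `L^{−1∕4}`).
WHAT IT DOES NOT DO: the five second-order traces for the balls (needs the two-insertion defect law + generic-ratio sockets); any value of a constant.  SUPPLIER work;
NEVER «G-an2-4 closed»; NOT (CONV-C), NOT D1, NOT `BetaPertH`, NOT continuum, NOT Clay.  Records: `HOME/b2b-balaban-gan24-p3/gen64/README.md`.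
-/

noncomputable section

open scoped BigOperators ComplexConjugate Matrix Matrix.Norms.L2Operator Kronecker
open Filter Topology Finset Matrix

namespace Summit.QuantumFields.BalabanUV.Beta.GAN24.IndicatorBallAlmostNested

open Literature.MathematicalPhysics.QuantumFieldTheory.Balaban1983to89
open Literature.MathematicalPhysics.QuantumFieldTheory.Balaban1983to89.B5Prop11Plancherel (Tor fine)
open Literature.MathematicalPhysics.QuantumFieldTheory.Balaban1983to89.B5Blocks16 (bpt_val)
open Literature.MathematicalPhysics.QuantumFieldTheory.Balaban1983to89.B5RealFields (reM)
open Literature.MathematicalPhysics.QuantumFieldTheory.Balaban1983to89.B5G183RateUnitTower (lev)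
open Literature.MathematicalPhysics.QuantumFieldTheory.Balaban1983to89.B5G183RateTorus (cpt)
open Literature.MathematicalPhysics.QuantumFieldTheory.Balaban1983to89.B5G183RateTorusW (off)
open Literature.MathematicalPhysics.QuantumFieldTheory.Balaban1983to89.B12Sec2to5 (betaPrime510)
open Literature.MathematicalPhysics.QuantumFieldTheory.Balaban1983to89.Beta (IsInfiniteVolumeLimit)
open Literature.MathematicalPhysics.QuantumFieldTheory.Balaban1983to89.Beta.FreeLegDictionary (cubic)
open Literature.MathematicalPhysics.QuantumFieldTheory.Balaban1983to89.Beta.BlockKernelVolumeSockets (evenPeriod tendsto_evenPeriod)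
open Literature.MathematicalPhysics.QuantumFieldTheory.Balaban1983to89.Beta.VectorTails (castT liftZ)
open Literature.MathematicalPhysics.QuantumFieldTheory.Balaban1983to89.Beta.VectorTailsCov (tdist)
open Literature.MathematicalPhysics.QuantumFieldTheory.Balaban1983to89.Beta.PoissonInterior (supNorm supNorm_le_iff)
open Literature.MathematicalPhysics.QuantumFieldTheory.Balaban1983to89.Beta.LimitRate (StepRate limKernelOf KernelInputs)
open Literature.MathematicalPhysics.QuantumFieldTheory.Balaban1983to89.Beta.CompositionSingular (flucCov)
open Literature.MathematicalPhysics.QuantumFieldTheory.Balaban1983to89.Beta.BlockEffectiveAction (DelK)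
open Summit.QuantumFields.BalabanUV.T4Continuum.BalabanLineAverage (QB)
open Summit.QuantumFields.BalabanUV.T4Continuum.BalabanAveragedTowerModes (par rem cpt_par_add_off_rem val_cpt_add_off)
open Summit.QuantumFields.BalabanUV.T4Continuum.CovariantAveragingTower (avgTow)
open Summit.QuantumFields.BalabanUV.T4Continuum.BalabanAveragedTowerUnit (idx QBlev calGlev unitCovB one_le_lev')
open Summit.QuantumFields.BalabanUV.T4Continuum.BalabanAveragedCoerciveTower (unitIdx)
open Summit.QuantumFields.BalabanUV.T4Continuum.KingPairingPlantedLaw (JK JK_conjTranspose_mul_JK)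
open Summit.QuantumFields.BalabanUV.T4Continuum.BlockPairingGeometry (parT)
open Summit.QuantumFields.BalabanUV.T4Continuum.CTKingTowerWeights (rho rhoSite ctr toM val_toM rho_apply distK)
open Summit.QuantumFields.BalabanUV.T4Continuum.FirstOrderBackgroundModel (Pmodel)
open Summit.QuantumFields.BalabanUV.Beta.GAN24.BoundedBackgroundLegs (indicator_bound indicator_loc tendsto_indicator_reading)
open Summit.QuantumFields.BalabanUV.Beta.GAN24.AlmostNestedWordRate (JK_conjTranspose_mul_diagonal_mul_JK)
open Summit.QuantumFields.BalabanUV.Beta.GAN24.AlmostNestedLoopEnd (conv_oneLoop_loopCov_almostNestedLegs)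

variable {d : ℕ} (L : ℕ) [NeZero L]

/-! ## §1 Arithmetic: representatives of least absolute value under `t ↦ L·t + j` -/

section Arith

/-- `|valMinAbs x| ≤ r` iff `x` has an integer representative of absolute value `≤ r` (the centred lift minimises the absolute value, `ZMod.natAbs_min_of_le_div_two`).
[folklore] -/
theorem natAbs_valMinAbs_le_iff_exists {m : ℕ} [NeZero m] (x : ZMod m) (r : ℕ) :
    x.valMinAbs.natAbs ≤ r ↔ ∃ i : ℤ, i.natAbs ≤ r ∧ (i : ZMod m) = x := by
  constructor
  · intro h; exact ⟨x.valMinAbs, h, ZMod.coe_valMinAbs x⟩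
  · rintro ⟨i, hi, he⟩
    exact (ZMod.natAbs_min_of_le_div_two m x.valMinAbs i (by rw [ZMod.coe_valMinAbs, he]) (ZMod.natAbs_valMinAbs_le x)).trans hi

/-- **`child_ball_iff` — THE BALL IS NESTED OFF ITS FAR FACE, ONE COORDINATE**: for `N′ = L·N`, `0 ≤ j < L` and `t ≢ n (mod N)`:
`|valMinAbs_{N′}(L·t + j)| ≤ L·n ⟺ |valMinAbs_N(t)| ≤ n` (representatives: `L·i + j` with `|i| ≤ n`, `i ≠ n` has `|L·i + j| ≤ L·n`; conversely a representative `i′` of `L·t + j`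
is `≡ j (mod L)`, `i′ = L·i + j`, and `|i′| ≤ L·n` forces `|i| ≤ n`). [folklore] -/
theorem child_ball_iff {N N' L n : ℕ} [NeZero N] [NeZero N'] (hN' : N' = L * N) (hL : 0 < L) (t : ℤ) (j : ℕ) (hj : j < L)
    (ht : (t : ZMod N) ≠ ((n : ℕ) : ZMod N)) :
    ((((L : ℤ) * t + j : ℤ)) : ZMod N').valMinAbs.natAbs ≤ L * n ↔ ((t : ℤ) : ZMod N).valMinAbs.natAbs ≤ n := by
  rw [natAbs_valMinAbs_le_iff_exists, natAbs_valMinAbs_le_iff_exists]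
  have hLz : (0 : ℤ) < L := by exact_mod_cast hL
  have hN'z : (N' : ℤ) = L * N := by rw [hN']; push_cast; ring
  constructor
  · rintro ⟨i', hi', he'⟩
    rw [ZMod.intCast_eq_intCast_iff_dvd_sub, hN'z] at he'
    have hLdvd : (L : ℤ) ∣ ((L : ℤ) * t + j) - i' := (dvd_mul_right (L : ℤ) N).trans he'
    have hLdvd' : (L : ℤ) ∣ (j : ℤ) - i' := by
      have e1 : ((L : ℤ) * t + j) - i' = L * t + ((j : ℤ) - i') := by ring
      rw [e1] at hLdvd
      exact (dvd_add_right (dvd_mul_right (L : ℤ) t)).mp hLdvd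
    set i : ℤ := i' / L with hi_def
    have hr : i' % L = j := by
      have h4 : i' % L = (j : ℤ) % L := Int.modEq_iff_dvd.mpr hLdvd'
      rw [h4, Int.emod_eq_of_lt (by positivity) (by exact_mod_cast hj)]
    have hi'eq : i' = L * i + j := by
      have := Int.emod_def i' L
      rw [hr] at this
      linarith
    refine ⟨i, ?_, ?_⟩
    · rw [hi'eq] at hi'
      by_contra hcon
      have hcon' : (n : ℤ) + 1 ≤ i ∨ i ≤ -((n : ℤ) + 1) := by omega
      rcases hcon' with h | h
      · have h1 : (L : ℤ) * n + L ≤ L * i := by nlinarith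
        omega
      · have h1 : (L : ℤ) * i ≤ -(L * n) - L := by nlinarith
        omega
    · rw [ZMod.intCast_eq_intCast_iff_dvd_sub]
      have h5 : (L : ℤ) * N ∣ L * (t - i) := by
        have : (L : ℤ) * t + j - i' = L * (t - i) := by rw [hi'eq]; ring
        rwa [this] at he'
      exact (mul_dvd_mul_iff_left hLz.ne').mp h5
  · rintro ⟨i, hi, he⟩
    have hin : i ≠ n := by rintro rfl; exact ht (by rw [← he]; norm_cast)
    refine ⟨L * i + j, ?_, ?_⟩
    · by_cases h0 : 0 ≤ i
      · have h1 : (L : ℤ) * i ≤ L * n - L := by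
          have : i ≤ n - 1 := by omega
          nlinarith
        have h2 : 0 ≤ (L : ℤ) * i := by positivity
        omega
      · have h1 : (L : ℤ) * i ≤ -L := by nlinarith
        have h2 : -((L : ℤ) * n) ≤ L * i := by
          have : -(n : ℤ) ≤ i := by omega
          nlinarith
        omega
    · rw [ZMod.intCast_eq_intCast_iff_dvd_sub, hN'z]
      rw [ZMod.intCast_eq_intCast_iff_dvd_sub] at he
      have : (L : ℤ) * t + j - (L * i + j) = L * (t - i) := by ring
      rw [this]
      exact mul_dvd_mul_left (L : ℤ) he

end Arith

/-! ## §2 Block sums through King's pairing -/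

section Blocks

variable {D : ℕ} (N R : ℕ) [NeZero N] [NeZero R] (M : Fin D → ℕ) [hM : ∀ μ, NeZero (M μ)]

omit [NeZero L] in
/-- **`blockavg_const`** — the block average of a constant is the constant: `R^{−D}·Σ_{parT y = u} c = c` (entry `(u,u)` of `J_Rᴴ·(c•1)·J_R = c•1`, `JK_conjTranspose_mul_JK`).
[cite: King1986, (2.10) p.653 (block parent)] [folklore] -/
theorem blockavg_const (u : Tor (fine N M) × Fin D) (c : ℂ) :
    ((R : ℂ) ^ D)⁻¹ * ∑ _x ∈ univ.filter (fun x : Tor (fine (R * N) M) × Fin D => parT N R M x = u), c = c := by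
  have h := JK_conjTranspose_mul_diagonal_mul_JK M N R (fun _ : Tor (fine (R * N) M) × Fin D => c)
  have h1 : Matrix.diagonal (fun _ : Tor (fine (R * N) M) × Fin D => c) = c • (1 : Matrix (Tor (fine (R * N) M) × Fin D) (Tor (fine (R * N) M) × Fin D) ℂ) := by
    ext i j
    by_cases hij : i = j
    · subst hij; simp
    · simp [hij, Matrix.one_apply_ne hij]
  rw [h1, Matrix.mul_smul, Matrix.mul_one, Matrix.smul_mul, JK_conjTranspose_mul_JK] at h
  have h2 := congrFun (congrFun h u) u
  rw [Matrix.smul_apply, Matrix.one_apply_eq, Matrix.diagonal_apply_eq, smul_eq_mul, mul_one] at h2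
  exact h2.symm

omit [NeZero L] in
/-- a child of `u` under the block parent is `(cpt u₁ + off (rem y₁), u₂)` (`cpt_par_add_off_rem`). [folklore] -/
theorem eq_cpt_add_off_of_parT {y : Tor (fine (R * N) M) × Fin D} {u : Tor (fine N M) × Fin D} (h : parT N R M y = u) :
    y.1 = cpt N R M u.1 + off N R M (rem N R M y.1) ∧ y.2 = u.2 := by
  have h1 : par N R M y.1 = u.1 := congrArg Prod.fst h
  have h2 : y.2 = u.2 := congrArg Prod.snd h
  refine ⟨?_, h2⟩
  rw [← h1]
  exact (cpt_par_add_off_rem N R M y.1).symm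

end Blocks

/-! ## §3 The ball geometry: membership by coordinates, the corner one level up, nesting off the far faces -/

section Ball

variable {D : ℕ} (M : Fin D → ℕ) [hM : ∀ μ, NeZero (M μ)]

omit hM in
/-- **`rho_nonpos_iff`** — `ρ_{k,x}(u) ≤ 0 ⟺ ∀ ν, |valMinAbs(u₁(ν) − c_ν)| ≤ n_k` (`ρ = tdist(c, u₁)∕n_k − 1`, `tdist = ‖liftZ(u₁ − c)‖_∞`). [folklore] -/
theorem rho_nonpos_iff (k : ℕ) (x : idx L M 0) (u : idx L M k) :
    rho L M k x u ≤ 0 ↔ ∀ ν, ((u.1 ν - ctr L M k x ν).valMinAbs).natAbs ≤ lev L k := by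
  have hn : (0 : ℝ) < (lev L k : ℝ) := by exact_mod_cast one_le_lev' L k
  rw [rho_apply]
  unfold rhoSite
  rw [sub_nonpos, div_le_one hn, Nat.cast_le]
  show supNorm (liftZ (u.1 - ctr L M k x)) ≤ lev L k ↔ _
  rw [supNorm_le_iff]
  rfl

/-- the corner one level up: `(ctr_{k+1} x)_ν = L·(ctr_k x)_ν` in values (`ctr_k x = bpt n_k (toM x₁) 0`, `bpt_val`). [folklore] -/
theorem val_ctr_succ (k : ℕ) (x : idx L M 0) (ν : Fin D) : (ctr L M (k + 1) x ν).val = L * (ctr L M k x ν).val := by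
  unfold ctr
  rw [bpt_val, bpt_val]
  simp only [Pi.zero_apply, Fin.val_zero, add_zero]
  rw [show lev L (k + 1) = L * lev L k from rfl, Nat.mul_assoc]

/-- **`rho_succ_child_iff` — THE BALL IS NESTED OFF ITS FAR FACES**: if `u₁(ν) ≠ c_ν + n_k` for every `ν`, then for every child `y` of `u` (`parT y = u`):
`ρ_{k+1,x}(y) ≤ 0 ⟺ ρ_{k,x}(u) ≤ 0` (§1's `child_ball_iff` in each coordinate: `y₁(ν) − c′_ν = L·(u₁(ν) − c_ν) + j_ν`). [folklore] -/
theorem rho_succ_child_iff (k : ℕ) (x : idx L M 0) (u : idx L M k) (hu : ∀ ν, u.1 ν ≠ ctr L M k x ν + ((lev L k : ℕ) : ZMod (fine (lev L k) M ν)))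
    (y : idx L M (k + 1)) (hy : parT (lev L k) L M y = u) : rho L M (k + 1) x y ≤ 0 ↔ rho L M k x u ≤ 0 := by
  have hL : 0 < L := Nat.pos_of_ne_zero (NeZero.ne L)
  obtain ⟨hy1, -⟩ := eq_cpt_add_off_of_parT (lev L k) L M hy
  rw [rho_nonpos_iff, rho_nonpos_iff]
  refine forall_congr' fun ν => ?_
  -- the two differences in values
  set a : ℕ := (u.1 ν).val with ha
  set b : ℕ := (ctr L M k x ν).val with hb
  set j : ℕ := (rem (lev L k) L M y.1 ν : ℕ) with hj
  have hjL : j < L := (rem (lev L k) L M y.1 ν).isLt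
  have e1 : u.1 ν - ctr L M k x ν = (((a : ℤ) - b : ℤ) : ZMod (fine (lev L k) M ν)) := by
    push_cast
    rw [ha, hb, ZMod.natCast_zmod_val, ZMod.natCast_zmod_val]
  have hyv : (y.1 ν).val = L * a + j :=
    (congrArg (fun z : Tor (fine (L * lev L k) M) => (z ν).val) hy1).trans (val_cpt_add_off (lev L k) L M u.1 (rem (lev L k) L M y.1) ν)
  have e2 : y.1 ν - ctr L M (k + 1) x ν = ((((L : ℤ) * ((a : ℤ) - b) + j : ℤ)) : ZMod (fine (lev L (k + 1)) M ν)) := by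
    have h1 : y.1 ν = (((y.1 ν).val : ℕ) : ZMod (fine (lev L (k + 1)) M ν)) := (ZMod.natCast_zmod_val _).symm
    have h2 : ctr L M (k + 1) x ν = (((ctr L M (k + 1) x ν).val : ℕ) : ZMod (fine (lev L (k + 1)) M ν)) := (ZMod.natCast_zmod_val _).symm
    rw [h1, h2, hyv, val_ctr_succ, ← hb]
    push_cast
    ring
  have ht : (((a : ℤ) - b : ℤ) : ZMod (fine (lev L k) M ν)) ≠ ((lev L k : ℕ) : ZMod (fine (lev L k) M ν)) := by
    rw [← e1]
    intro h
    exact hu ν (by rw [← h]; abel)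
  rw [e1, e2]
  exact child_ball_iff (N := fine (lev L k) M ν) (N' := fine (lev L (k + 1)) M ν) (show fine (lev L (k + 1)) M ν = L * fine (lev L k) M ν from Nat.mul_assoc _ _ _)
    hL _ j hjL ht

end Ball

/-! ## §4 The indicator balls are almost nested; V196's END with nothing displayed -/

section Family

variable {D : ℕ} {side : ℕ → ℕ} [hs : ∀ t, NeZero (side t)]

omit hs in
/-- the indicator family has the single direction `x₂`. [folklore] -/
theorem indicatorBall_dir {V : (t : ℕ) → idx L (cubic D (side t)) 0 → (k : ℕ) → Fin D → (idx L (cubic D (side t)) k → ℂ)}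
    (hVdef : ∀ t x k μ u, V t x k μ u = if μ = x.2 then (if rho L (cubic D (side t)) k x u ≤ 0 then 1 else 0) else 0) (t : ℕ) (x : idx L (cubic D (side t)) 0)
    (k : ℕ) (μ : Fin D) (u : idx L (cubic D (side t)) k) (h : μ ≠ x.2) : V t x k μ u = 0 := by
  rw [hVdef, if_neg h]

/-- **`indicatorBall_blockavg` — THE INDICATOR BALLS ARE ALMOST NESTED, ONE DEFECT LAYER PER DIRECTION**: off the far faces `{c_ν + n_k}`, the block average of `V^{(k+1)}_{x₂}` over
the children of `u` is `V^{(k)}_{x₂}(u)` (every child has the same indicator as `u`, §3; the average of a constant, §2). [folklore] -/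
theorem indicatorBall_blockavg {V : (t : ℕ) → idx L (cubic D (side t)) 0 → (k : ℕ) → Fin D → (idx L (cubic D (side t)) k → ℂ)}
    (hVdef : ∀ t x k μ u, V t x k μ u = if μ = x.2 then (if rho L (cubic D (side t)) k x u ≤ 0 then 1 else 0) else 0) (t : ℕ) (x : idx L (cubic D (side t)) 0)
    (k : ℕ) (u : idx L (cubic D (side t)) k)
    (hu : ∀ ν, u.1 ν ∉ ({ctr L (cubic D (side t)) k x ν + ((lev L k : ℕ) : ZMod (fine (lev L k) (cubic D (side t)) ν))} : Finset (ZMod (fine (lev L k) (cubic D (side t)) ν)))) :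
    ((L : ℂ) ^ D)⁻¹ * ∑ y ∈ univ.filter (fun y : idx L (cubic D (side t)) (k + 1) => parT (lev L k) L (cubic D (side t)) y = u), V t x (k + 1) x.2 y = V t x k x.2 u := by
  have hu' : ∀ ν, u.1 ν ≠ ctr L (cubic D (side t)) k x ν + ((lev L k : ℕ) : ZMod (fine (lev L k) (cubic D (side t)) ν)) := fun ν h => hu ν (by rw [h]; exact mem_singleton_self _)
  have hc : ∀ y ∈ univ.filter (fun y : idx L (cubic D (side t)) (k + 1) => parT (lev L k) L (cubic D (side t)) y = u), V t x (k + 1) x.2 y = V t x k x.2 u := by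
    intro y hy
    have hy' := (mem_filter.mp hy).2
    rw [hVdef, hVdef, if_pos rfl, if_pos rfl]
    exact if_congr (rho_succ_child_iff L (cubic D (side t)) k x u hu' y hy') rfl rfl
  rw [sum_congr rfl hc]
  exact blockavg_const (lev L k) L (cubic D (side t)) u _

end Family

variable (Lb : ℕ) [NeZero Lb] (a : ℝ) (ha : 0 < a)

/-- **`conv_oneLoop_loopCov_indicatorBallLegs` — V196's ONE-LOOP CONTRACTION END FOR THE INDICATOR BALLS, NOTHING DISPLAYED** [our proof] (`d + 1 ≥ 3`, `L ≥ 2`, every `Lb ≥ 1`,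
`a > 0`, `μ ≠ ν`; PART 213 §4's family `V_{t,x}^{(k)}(u)_μ = [μ = x₂]·𝟙[ρ_{k,x}(u) ≤ 0]` DISPLAYED as the hypothesis `hVdef`, no definition; step ratio `L^{−1∕4}`): PART 229's
`conv_oneLoop_loopCov_almostNestedLegs` at `(α, c₀, m) = (1, 0, 1)` fed with §4 (almost nesting off the far faces), PART 213 §4 (bound, support, EL₁) and `indicatorBall_dir`.  A
bounded background that is NEITHER Lipschitz NOR nested, with V196's loop contraction an unconditional theorem. [cite: Balaban1987RG1, (1.20)–(1.22) p.264 (shapes)] -/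
theorem conv_oneLoop_loopCov_indicatorBallLegs (hL : 2 ≤ L) (hd : 2 ≤ d) {μ ν : Fin (d + 1)} (hne : μ ≠ ν)
    {V : (t : ℕ) → idx L (fine (Lb * 1) (cubic (d + 1) (evenPeriod t))) 0 → (k : ℕ) → Fin (d + 1) → (idx L (fine (Lb * 1) (cubic (d + 1) (evenPeriod t))) k → ℂ)}
    (hVdef : ∀ t x k μ u, V t x k μ u = if μ = x.2 then (if rho L (fine (Lb * 1) (cubic (d + 1) (evenPeriod t))) k x u ≤ 0 then 1 else 0) else 0) :
    ∃ κ₁ C C' : ℝ, 0 < κ₁ ∧ 0 ≤ C ∧ 0 ≤ C' ∧ ∃ Pinf : ℕ → B12Beta.Kernel (d + 1),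
      (∀ k, IsInfiniteVolumeLimit (fun t => Lb * 1 * evenPeriod t)
        (fun t μ' ν' (z : Beta.Site (d + 1) (Lb * 1 * evenPeriod t)) => (((Matrix.of fun (x : idx L (fine (Lb * 1) (cubic (d + 1) (evenPeriod t))) 0) (q : idx L (fine (Lb * 1) (cubic (d + 1) (evenPeriod t))) 0 × idx L (fine (Lb * 1) (cubic (d + 1) (evenPeriod t))) 0) => avgTow (QBlev L (fine (Lb * 1) (cubic (d + 1) (evenPeriod t)))) ((L : ℝ) ^ (d + 1)) (fun k => calGlev L (fine (Lb * 1) (cubic (d + 1) (evenPeriod t))) a ha k * Pmodel L (fine (Lb * 1) (cubic (d + 1) (evenPeriod t))) (V t x) k * calGlev L (fine (Lb * 1) (cubic (d + 1) (evenPeriod t))) a ha k) k q.1 q.2) * ((((unitCovB L (fine (Lb * 1) (cubic (d + 1) (evenPeriod t))) a ha k)⁻¹ * (((flucCov (reM (DelK (lev L k) (one_le_lev' L k) (fine (Lb * 1) (cubic (d + 1) (evenPeriod t))) a ha)) (Matrix.fromRows (reM (QB 1 Lb (cubic (d + 1) (evenPeriod t)))) (fun (t' : {x : Tor (fine (Lb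 * 1) (cubic (d + 1) (evenPeriod t))) × Fin (d + 1) // (∀ ν, ν < x.2 → ((rem 1 Lb (cubic (d + 1) (evenPeriod t)) x.1 ν : ℕ)) = 0) ∧ ((rem 1 Lb (cubic (d + 1) (evenPeriod t)) x.1 x.2 : ℕ)) + 1 < Lb}) (x : Tor (fine (Lb * 1) (cubic (d + 1) (evenPeriod t))) × Fin (d + 1)) => if x = (Function.Embedding.subtype (fun x : Tor (fine (Lb * 1) (cubic (d + 1) (evenPeriod t))) × Fin (d + 1) => (∀ ν, ν < x.2 → ((rem 1 Lb (cubic (d + 1) (evenPeriod t)) x.1 ν : ℕ)) = 0) ∧ ((rem 1 Lb (cubic (d + 1) (evenPeriod t)) x.1 x.2 : ℕ)) + 1 < Lb)) t' then (1 : ℝ) else 0))).map ((↑) : ℝ → ℂ)).submatrix (unitIdx L (fine (Lb * 1) (cubic (d + 1) (evenPeriod t)))) (unitIdx L (fine (Lb * 1) (cubic (d + 1) (evenPeriod t))))) * (unitCovB L (fine (Lb * 1) (cubic (d + 1) (evenPeriod t))) a ha k)⁻¹)) ⊗ₖ (((unitCovB L (fine (Lb * 1) (cubic (d + 1) (evenPeriod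 t))) a ha k)⁻¹ * (((flucCov (reM (DelK (lev L k) (one_le_lev' L k) (fine (Lb * 1) (cubic (d + 1) (evenPeriod t))) a ha)) (Matrix.fromRows (reM (QB 1 Lb (cubic (d + 1) (evenPeriod t)))) (fun (t' : {x : Tor (fine (Lb * 1) (cubic (d + 1) (evenPeriod t))) × Fin (d + 1) // (∀ ν, ν < x.2 → ((rem 1 Lb (cubic (d + 1) (evenPeriod t)) x.1 ν : ℕ)) = 0) ∧ ((rem 1 Lb (cubic (d + 1) (evenPeriod t)) x.1 x.2 : ℕ)) + 1 < Lb}) (x : Tor (fine (Lb * 1) (cubic (d + 1) (evenPeriod t))) × Fin (d + 1)) => if x = (Function.Embedding.subtype (fun x : Tor (fine (Lb * 1) (cubic (d + 1) (evenPeriod t))) × Fin (d + 1) => (∀ ν, ν < x.2 → ((rem 1 Lb (cubic (d + 1) (evenPeriod t)) x.1 ν : ℕ)) = 0) ∧ ((rem 1 Lb (cubic (d + 1) (evenPeriod t)) x.1 x.2 : ℕ)) + 1 < Lb)) t' then (1 : ℝ) else 0))).map ((↑) : ℝ → ℂ)).submatrix (unitIdx L (fine (Lb * 1) (cubic (d +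 1) (evenPeriod t)))) (unitIdx L (fine (Lb * 1) (cubic (d + 1) (evenPeriod t))))) * (unitCovB L (fine (Lb * 1) (cubic (d + 1) (evenPeriod t))) a ha k)⁻¹))) * ((Matrix.of fun (x : idx L (fine (Lb * 1) (cubic (d + 1) (evenPeriod t))) 0) (q : idx L (fine (Lb * 1) (cubic (d + 1) (evenPeriod t))) 0 × idx L (fine (Lb * 1) (cubic (d + 1) (evenPeriod t))) 0) => avgTow (QBlev L (fine (Lb * 1) (cubic (d + 1) (evenPeriod t)))) ((L : ℝ) ^ (d + 1)) (fun k => calGlev L (fine (Lb * 1) (cubic (d + 1) (evenPeriod t))) a ha k * Pmodel L (fine (Lb * 1) (cubic (d + 1) (evenPeriod t))) (V t x) k * calGlev L (fine (Lb * 1) (cubic (d + 1) (evenPeriod t))) a ha k) k q.1 q.2))ᴴ) ((unitIdx L (fine (Lb * 1) (cubic (d + 1) (evenPeriod t)))).symm (z, μ')) ((unitIdx L (fine (Lb * 1) (cubic (d + 1) (evenPeriod t)))).symm (0, ν'))).re) (Pinf k)) ∧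
      Beta.LimitRate.UniformDecay Pinf μ ν C ((κ₁ / 4) / (((d + 1 : ℕ)) : ℝ)) ∧
      StepRate Pinf μ ν C' ((κ₁ / 4) / (((d + 1 : ℕ)) : ℝ)) (Real.sqrt (Real.sqrt ((L : ℝ)⁻¹))) ∧
      (∃ K : KernelInputs (d + 1) Pinf, K.θ = Real.sqrt (Real.sqrt ((L : ℝ)⁻¹)) ∧ K.c₀ = betaPrime510 (d + 1) (C' / (1 - Real.sqrt (Real.sqrt ((L : ℝ)⁻¹)))) ((κ₁ / 4) / (((d + 1 : ℕ)) : ℝ)) ∧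
        K.Pinf = limKernelOf Pinf ∧ K.μ = μ ∧ K.ν = ν) ∧
      (∀ k, |B12Beta.secondMoment (Pinf k) μ ν - B12Beta.secondMoment (limKernelOf Pinf) μ ν|
          ≤ betaPrime510 (d + 1) (C' / (1 - Real.sqrt (Real.sqrt ((L : ℝ)⁻¹)))) ((κ₁ / 4) / (((d + 1 : ℕ)) : ℝ)) * Real.sqrt (Real.sqrt ((L : ℝ)⁻¹)) ^ k) :=
  conv_oneLoop_loopCov_almostNestedLegs L Lb a ha hL hd hne (α := 1) (c₀ := 0) zero_le_one (m := 1)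
    (fun t x k μ₀ u => indicator_bound L (D := d + 1) (side := fun t => Lb * 1 * evenPeriod t) (V := V) hVdef t x k μ₀ u)
    (fun t x k μ₀ u h => indicatorBall_dir L (D := d + 1) (side := fun t => Lb * 1 * evenPeriod t) (V := V) hVdef t x k μ₀ u h)
    (fun t x k ν' => {ctr L (fine (Lb * 1) (cubic (d + 1) (evenPeriod t))) k x ν' + ((lev L k : ℕ) : ZMod (fine (lev L k) (fine (Lb * 1) (cubic (d + 1) (evenPeriod t))) ν'))})
    (fun _ _ _ _ => (card_singleton _).le)
    (fun t x k u hu => indicatorBall_blockavg L (D := d + 1) (side := fun t => Lb * 1 * evenPeriod t) (V := V) hVdef t x k u hu)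
    (fun t x k μ₀ u h => indicator_loc L (D := d + 1) (side := fun t => Lb * 1 * evenPeriod t) (V := V) hVdef t x k μ₀ u h)
    (fun z μ' k μ₀ f w => tendsto_indicator_reading L (D := d + 1) (side := fun t => Lb * 1 * evenPeriod t)
      (Filter.Tendsto.const_mul_atTop' (Nat.pos_of_ne_zero (NeZero.ne (Lb * 1))) tendsto_evenPeriod) (V := V) hVdef z μ' k μ₀ f w)

end Summit.QuantumFields.BalabanUV.Beta.GAN24.IndicatorBallAlmostNested

end
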